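import Literature.NumberTheory.EllipticCurves.NeronModelWeilExtension
import Literature.AlgebraicGeometry.Resolution.ExceptionalLocusPurity
import HarnessLib

/-!
# A smooth proper model which is a group chunk of a smooth group scheme IS that group scheme (road W, node (W23))
# — [BLRNeronModels1990, §4.3–4.4] [Artin1986NeronModels, Prop. (1.3)] [EGAIV4, 21.12.12]

Topic `Literature/NumberTheory/DiophantineGeometry`; THEOREMS ONLY (no definition / named fact / instance); net Literature debt 0.
Cell `hodgecm-mathlib` (D-0151), road W (r₀ as a theorem), nodes (W2)+(W3); B-plan1 RULING (R-W23) 2026-08-28: lead A-p14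
(§0, §1, §4), second A-p11 (§2–§3 = his pre-staged inputs 391ce3c6 verbatim; author of the purity engine ★ `ExceptionalLocusPurity`).
**Head** `exists_iso_of_isOpenImmersion_of_codimOne`: `R` a dvr with fraction field `K`; `𝒳 → Spec R` smooth proper, `G → Spec R`
a smooth separated group scheme locally of finite type, both with integral total space; `U ⊆ 𝒳` open containing the generic
fibre and every point of codimension `≤ 1` (`…_of_isIrreducible_specialFibre`: irreducible special fibre meeting `U`);
`j : U ↪ G` an open immersion over `R` ⇒ `j` extends to an isomorphism `𝒳 ≅ G` over `R`, unique among extensions.  Proof: Weil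
extension (★ `weil_extension_of_codimOne` made global, §2–§3) gives `f : 𝒳 → G`; `f` is proper, dominant, generically a stalk
isomorphism, `G` is regular ★ `isRegularLocalRing_stalk_of_smooth_dvr`, and the points of codimension `≤ 1` lie in `U` where
`f = j`; so purity + ZMT (§3, from ★ `ExceptionalLocusPurity`) make `f` an isomorphism; uniqueness ★ `hom_ext_of_ι_comp_eq`.
HC_CM is proved only modulo the 7 printed citations until rung 0 closes.
-/


noncomputable section

universe u

open CategoryTheory Limits AlgebraicGeometry IsLocalRing
open Literature.NumberTheory.EllipticCurves Literature.AlgebraicGeometry.Resolution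

namespace Literature.NumberTheory.DiophantineGeometry

/-! ### §0 Plumbing: a morphism restricting to an open immersion on `U` -/

/-- If `U.ι ≫ f = j` with `j` an open immersion, the stalk map of `f` at a point of `U` is an isomorphism. [folklore] -/
private theorem isIso_stalkMap_of_ι_comp_eq {X Y : Scheme.{u}} (U : X.Opens) (f : X ⟶ Y) (j : (U : Scheme.{u}) ⟶ Y)
    [IsOpenImmersion j] (h : U.ι ≫ f = j) (x : X) (hx : x ∈ U) : IsIso (f.stalkMap x) := by
  subst h
  have hc : IsIso ((U.ι ≫ f).stalkMap ⟨x, hx⟩) := inferInstance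
  rw [Scheme.Hom.stalkMap_comp] at hc
  exact (@IsIso.of_isIso_comp_right _ _ _ _ _ (f.stalkMap (U.ι.base ⟨x, hx⟩)) (U.ι.stalkMap ⟨x, hx⟩) inferInstance hc :
    IsIso (f.stalkMap x))

/-- If `U.ι ≫ f = j` with `j` an open immersion, `U` non-empty and `Y` irreducible, then `f` is dominant. [folklore] -/
private theorem isDominant_of_ι_comp_eq {X Y : Scheme.{u}} [IrreducibleSpace Y] (U : X.Opens) (hUne : (U : Set X).Nonempty)
    (f : X ⟶ Y) (j : (U : Scheme.{u}) ⟶ Y) [IsOpenImmersion j] (h : U.ι ≫ f = j) : IsDominant f := by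
  refine ⟨?_⟩
  have hopen : IsOpen (Set.range j.base) := j.isOpenEmbedding.isOpen_range
  obtain ⟨x, hx⟩ := hUne
  have hne : (Set.range j.base).Nonempty := ⟨j.base ⟨x, hx⟩, ⟨_, rfl⟩⟩
  have hsub : Set.range j.base ⊆ Set.range f.base := by
    rintro _ ⟨y, rfl⟩
    exact ⟨U.ι.base y, by rw [← Scheme.Hom.comp_apply, h]⟩
  exact Dense.mono hsub (hopen.dense hne)  -- a non-empty open subset of an irreducible space is dense

/-! ### §1 Points of codimension `≤ 1` of a model with irreducible special fibre -/

/-- A chain of two strict specializations `x₂ ⤳ x₁ ⤳ x₀` forces `2 ≤ dim 𝒪_{X,x₀}`: the generizations of `x₀` are the points of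
`Spec 𝒪_{X,x₀}` (a topological embedding, Stacks 01J7), where specialization is inclusion of primes (so `dim 𝒪_{X,x₀}` is the
codimension of `x₀`, Stacks 02IZ). [cite: StacksProject, Tag 02IZ] [cite: StacksProject, Tag 01J7] -/
theorem two_le_ringKrullDim_stalk_of_specializes {X : Scheme.{u}} {x₂ x₁ x₀ : X} (h₂₁ : x₂ ⤳ x₁) (h₁₀ : x₁ ⤳ x₀)
    (hne₂₁ : x₂ ≠ x₁) (hne₁₀ : x₁ ≠ x₀) : (2 : WithBot ℕ∞) ≤ ringKrullDim (X.presheaf.stalk x₀) := by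
  let ι := X.fromSpecStalk x₀
  have hrange : ∀ y : X, y ⤳ x₀ → ∃ p : PrimeSpectrum (X.presheaf.stalk x₀), ι.base p = y := fun y hy => by
    have : y ∈ Set.range ι.base := by rw [Scheme.range_fromSpecStalk]; exact hy
    exact this
  obtain ⟨p₀, hp₀⟩ := hrange x₀ le_rfl
  obtain ⟨p₁, hp₁⟩ := hrange x₁ h₁₀
  obtain ⟨p₂, hp₂⟩ := hrange x₂ (h₂₁.trans h₁₀)
  have hemb : Topology.IsEmbedding ι.base := ι.isEmbedding
  have hsp : ∀ (p q : PrimeSpectrum (X.presheaf.stalk x₀)), ι.base p ⤳ ι.base q → p.asIdeal ≤ q.asIdeal :=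
    fun p q h => (PrimeSpectrum.le_iff_specializes p q).mpr (hemb.isInducing.specializes_iff.mp h)
  have h21 : p₂.asIdeal < p₁.asIdeal := by
    refine lt_of_le_of_ne (hsp p₂ p₁ ?_) fun h => hne₂₁ ?_
    · rw [hp₂, hp₁]; exact h₂₁
    · calc x₂ = ι.base p₂ := hp₂.symm
        _ = ι.base p₁ := by rw [PrimeSpectrum.ext h]
        _ = x₁ := hp₁
  have h10 : p₁.asIdeal < p₀.asIdeal := by
    refine lt_of_le_of_ne (hsp p₁ p₀ ?_) fun h => hne₁₀ ?_
    · rw [hp₁, hp₀]; exact h₁₀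
    · calc x₁ = ι.base p₁ := hp₁.symm
        _ = ι.base p₀ := by rw [PrimeSpectrum.ext h]
        _ = x₀ := hp₀
  have h21' : p₂ < p₁ := h21
  have h10' : p₁ < p₀ := h10
  let l : LTSeries (PrimeSpectrum (X.presheaf.stalk x₀)) :=
    { length := 2
      toFun := ![p₂, p₁, p₀]
      step := fun i => by
        fin_cases i
        · exact h21'
        · exact h10' }
  have hl : l.length = 2 := rfl
  exact Order.le_krullDim_iff.mpr ⟨l, hl⟩

section SpecialFibre

variable {R : Type u} [CommRing R] [IsDomain R] [IsDiscreteValuationRing R]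
  {K : Type u} [Field K] [Algebra R K] [IsFractionRing R K]

/-- A point of `Spec R`, `R` a discrete valuation ring, off the generic point is the closed point. [folklore] -/
private theorem eq_closedPoint_of_not_mem_range_specGenericPoint (q : Spec (.of R))
    (hq : q ∉ Set.range (specGenericPoint R K).base) : q = closedPoint R := by
  apply PrimeSpectrum.ext
  haveI := q.isPrime
  by_contra hne
  apply hq
  refine ⟨closedPoint K, PrimeSpectrum.ext ?_⟩
  have hqbot : q.asIdeal = ⊥ := by
    rcases (IsDiscreteValuationRing.iff_pid_with_one_nonzero_prime R).mp ‹_› with ⟨-, P, -, hPu⟩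
    by_contra hq0
    exact hne ((hPu q.asIdeal ⟨hq0, inferInstance⟩).trans
      (hPu (maximalIdeal R) ⟨(isField_iff_maximalIdeal_eq.not.mp (IsDiscreteValuationRing.not_isField R)),
        inferInstance⟩).symm)
  rw [hqbot]
  change Ideal.comap (algebraMap R K) (maximalIdeal K) = ⊥
  rw [show maximalIdeal K = ⊥ from (isField_iff_maximalIdeal_eq).mp (Field.toIsField K),
    Ideal.comap_bot_of_injective _ (IsFractionRing.injective R K)]

/-- **The points of codimension `≤ 1` of a smooth `R`-scheme with integral total space and IRREDUCIBLE special fibre lie in any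
open `U` containing the generic fibre and meeting the special fibre**: such a point is either in the generic fibre or is the
generic point `ζ` of the special fibre (a further point `y` of the special fibre has the chain `η ⤳ ζ ⤳ y`, so
`dim 𝒪_{𝒳,y} ≥ 2`, Stacks 02IZ), and `ζ ∈ U` because `U` meets the irreducible special fibre. [cite: StacksProject, Tag 02IZ] -/
theorem mem_of_ringKrullDim_le_one_of_isIrreducible_specialFibre (𝒳 : Over (Spec (.of R))) [IsIntegral 𝒳.left]
    [Smooth 𝒳.hom] (hirr : IsIrreducible (𝒳.hom.base ⁻¹' {closedPoint R}))
    (U : 𝒳.left.Opens) (hU : 𝒳.hom.base ⁻¹' Set.range (specGenericPoint R K).base ⊆ (U : Set 𝒳.left))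
    (hUs : ((U : Set 𝒳.left) ∩ 𝒳.hom.base ⁻¹' {closedPoint R}).Nonempty)
    (y : 𝒳.left) (hy : ringKrullDim (𝒳.left.presheaf.stalk y) ≤ 1) : y ∈ U := by
  by_cases hyK : 𝒳.hom.base y ∈ Set.range (specGenericPoint R K).base
  · exact hU hyK
  -- `y` lies in the special fibre `Z`, an irreducible closed subset with generic point `ζ ∈ U`
  set Z : Set 𝒳.left := 𝒳.hom.base ⁻¹' {closedPoint R} with hZ
  have hyZ : y ∈ Z := eq_closedPoint_of_not_mem_range_specGenericPoint (K := K) _ hyK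
  have hZc : IsClosed Z :=
    ((PrimeSpectrum.isClosed_singleton_iff_isMaximal _).mpr (maximalIdeal.isMaximal R)).preimage 𝒳.hom.base.hom.continuous
  obtain ⟨ζ, hζ⟩ := QuasiSober.sober hirr hZc
  have hζU : ζ ∈ U := by
    obtain ⟨u, huU, huZ⟩ := hUs
    exact (hζ.mem_open_set_iff U.2).mpr ⟨u, huZ, huU⟩
  by_cases hyζ : y = ζ
  · rwa [hyζ]
  -- otherwise `η ⤳ ζ ⤳ y` is a chain of two strict specializations, contradicting `dim 𝒪_{𝒳,y} ≤ 1`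
  exfalso
  have hζy : ζ ⤳ y := hζ.specializes hyZ
  have hηζ : genericPoint 𝒳.left ⤳ ζ := genericPoint_specializes ζ
  have hζZ : ζ ∈ Z := hζ.mem
  have hne : genericPoint 𝒳.left ≠ ζ := by
    intro h
    have h1 : 𝒳.hom.base (genericPoint 𝒳.left) = closedPoint R := by rw [h]; exact hζZ
    rw [apply_genericPoint_eq, genericPoint_eq_bot_of_affine] at h1
    have h2 := congrArg PrimeSpectrum.asIdeal h1
    change (⊥ : Ideal R) = maximalIdeal R at h2
    exact (isField_iff_maximalIdeal_eq.not.mp (IsDiscreteValuationRing.not_isField R)) h2.symm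
  have h2 := two_le_ringKrullDim_stalk_of_specializes hηζ hζy hne (Ne.symm hyζ)
  exact absurd (h2.trans hy) (by decide)

end SpecialFibre
/-! ### §2–§3 Inputs (A-p11): extension is local on the source; Weil extension for an integral smooth source;
the purity/ZMT isomorphism criterion in dominant form -/

section LocalOnSource

variable (R : Type u) [CommRing R] (K : Type u) [Field K] [Algebra R K] [IsFractionRing R K]

/-- **The extension of a given `R`-morphism from an open containing the generic fibre is local on the source.**
Let `R` be a ring with field of fractions `K`, `𝒜 → Spec R` separated, `𝒳 → Spec R` flat, `𝒱` an open cover of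
`X`, `U ⊆ X` open containing the generic fibre and `g : U → 𝒜` an `R`-morphism.  If for every member `Vᵢ` the
restriction of `g` to `Vᵢ ∩ U` extends to an `R`-morphism `Vᵢ → 𝒜`, then `g` extends to an `R`-morphism `X → 𝒜`:
the extensions agree on `Vᵢ ∩ Vⱼ` because they agree on `U ∩ Vᵢ ∩ Vⱼ ⊇` the generic fibre
(`hom_ext_of_ι_comp_eq`); glue (`Scheme.Cover.glueMorphisms`).  [cite: Artin1986NeronModels, §1, (1.1)] -/
theorem openExtension_of_openCover_preimage (𝒜 𝒳 : Over (Spec (.of R))) [IsSeparated 𝒜.hom]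
    [Flat 𝒳.hom] (𝒱 : 𝒳.left.OpenCover) (U : 𝒳.left.Opens)
    (hU : 𝒳.hom.base ⁻¹' Set.range (specGenericPoint R K).base ⊆ (U : Set 𝒳.left))
    (g : (U : Scheme.{u}) ⟶ 𝒜.left)
    (H : ∀ (i : 𝒱.I₀) (r : ((𝒱.f i ⁻¹ᵁ U : (𝒱.X i).Opens) : Scheme.{u}) ⟶ (U : Scheme.{u})),
      r ≫ U.ι = (𝒱.f i ⁻¹ᵁ U).ι ≫ 𝒱.f i →
        ∃ f : 𝒱.X i ⟶ 𝒜.left, f ≫ 𝒜.hom = 𝒱.f i ≫ 𝒳.hom ∧ (𝒱.f i ⁻¹ᵁ U).ι ≫ f = r ≫ g) :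
    ∃ f : 𝒳.left ⟶ 𝒜.left, f ≫ 𝒜.hom = 𝒳.hom ∧ U.ι ≫ f = g := by
  -- the restrictions `gᵢ : Uᵢ = U ∩ Vᵢ → 𝒜`
  let Ui : ∀ i, (𝒱.X i).Opens := fun i => (𝒱.f i) ⁻¹ᵁ U
  have hUi_range : ∀ i, Set.range ((Ui i).ι ≫ 𝒱.f i).base ⊆ (U : Set 𝒳.left) := by
    rintro i _ ⟨y, rfl⟩
    exact y.2
  choose r hr using fun i => exists_lift_opens U ((Ui i).ι ≫ 𝒱.f i) (hUi_range i)
  choose f hf hfU using fun i => H i (r i) (hr i)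
  -- a restriction lemma: for `t : T → Vᵢ` landing in `Uᵢ`, `t ≫ fᵢ = (lift of t ≫ 𝒱.f i to U) ≫ g`
  have hres : ∀ (i : 𝒱.I₀) {T : Scheme.{u}} (t : T ⟶ 𝒱.X i) (t' : T ⟶ U),
      Set.range t.base ⊆ (Ui i : Set (𝒱.X i)) → t' ≫ U.ι = t ≫ 𝒱.f i → t ≫ f i = t' ≫ g := by
    intro i T t t' ht ht'
    obtain ⟨s, hs⟩ := exists_lift_opens (Ui i) t ht
    have hst : s ≫ r i = t' := by
      rw [← cancel_mono U.ι, Category.assoc, hr, ← Category.assoc, hs, ht']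
    rw [← hs, Category.assoc, hfU, ← Category.assoc, hst]
  -- compatibility on overlaps
  have hcompat : ∀ i j, pullback.fst (𝒱.f i) (𝒱.f j) ≫ f i =
      pullback.snd (𝒱.f i) (𝒱.f j) ≫ f j := by
    intro i j
    let 𝒲 : Over (Spec (.of R)) := Over.mk ((pullback.fst (𝒱.f i) (𝒱.f j) ≫ 𝒱.f i) ≫ 𝒳.hom)
    let p₁ : 𝒲.left ⟶ 𝒱.X i := pullback.fst (𝒱.f i) (𝒱.f j)
    let p₂ : 𝒲.left ⟶ 𝒱.X j := pullback.snd (𝒱.f i) (𝒱.f j)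
    have hp : p₁ ≫ 𝒱.f i = p₂ ≫ 𝒱.f j := pullback.condition
    change p₁ ≫ f i = p₂ ≫ f j
    haveI : Flat 𝒲.hom := by
      change Flat ((pullback.fst (𝒱.f i) (𝒱.f j) ≫ 𝒱.f i) ≫ 𝒳.hom)
      infer_instance
    let W : 𝒲.left.Opens := (p₁ ≫ 𝒱.f i) ⁻¹ᵁ U
    have hW : 𝒲.hom.base ⁻¹' Set.range (specGenericPoint R K).base ⊆ (W : Set 𝒲.left) :=
      fun y hy => hU hy
    have hcond : ∀ y : 𝒲.left, (p₁ ≫ 𝒱.f i).base y = (p₂ ≫ 𝒱.f j).base y := fun y => by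
      rw [hp]
    obtain ⟨w, hw⟩ := exists_lift_opens U (W.ι ≫ p₁ ≫ 𝒱.f i) (by
      rintro _ ⟨y, rfl⟩
      exact y.2)
    have e1 : (W.ι ≫ p₁) ≫ f i = w ≫ g :=
      hres i (W.ι ≫ p₁) w (by
        rintro _ ⟨y, rfl⟩
        exact y.2) (by rw [hw, Category.assoc])
    have e2 : (W.ι ≫ p₂) ≫ f j = w ≫ g :=
      hres j (W.ι ≫ p₂) w (by
        rintro _ ⟨y, rfl⟩
        change (p₂ ≫ 𝒱.f j).base y.1 ∈ (U : Set 𝒳.left)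
        rw [← hcond]
        exact y.2) (by rw [hw, Category.assoc, hp])
    refine hom_ext_of_ι_comp_eq R K 𝒜 𝒲 W hW (a := p₁ ≫ f i) (b := p₂ ≫ f j) ?_ ?_ ?_
    · change (p₁ ≫ f i) ≫ 𝒜.hom = (p₁ ≫ 𝒱.f i) ≫ 𝒳.hom
      rw [Category.assoc, hf, Category.assoc]
    · change (p₂ ≫ f j) ≫ 𝒜.hom = (p₁ ≫ 𝒱.f i) ≫ 𝒳.hom
      rw [Category.assoc, hf, hp, Category.assoc]
    · calc W.ι ≫ p₁ ≫ f i = (W.ι ≫ p₁) ≫ f i := (Category.assoc _ _ _).symm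
        _ = w ≫ g := e1
        _ = (W.ι ≫ p₂) ≫ f j := e2.symm
        _ = W.ι ≫ p₂ ≫ f j := Category.assoc _ _ _
  -- glue
  let gl : 𝒳.left ⟶ 𝒜.left := Scheme.Cover.glueMorphisms 𝒱 f hcompat
  have hgl : ∀ i, 𝒱.f i ≫ gl = f i := fun i => Scheme.Cover.ι_glueMorphisms 𝒱 f hcompat i
  refine ⟨gl, ?_, ?_⟩
  · refine Scheme.Cover.hom_ext 𝒱 _ _ fun i => ?_
    rw [← Category.assoc, hgl, hf]
  · refine Scheme.Cover.hom_ext (𝒱.pullback₁ U.ι) _ _ fun i => ?_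
    change pullback.fst U.ι (𝒱.f i) ≫ U.ι ≫ gl = pullback.fst U.ι (𝒱.f i) ≫ g
    rw [← Category.assoc, pullback.condition, Category.assoc, hgl]
    refine hres i (pullback.snd U.ι (𝒱.f i)) (pullback.fst U.ι (𝒱.f i)) ?_ pullback.condition
    rintro _ ⟨y, rfl⟩
    change (𝒱.f i).base ((pullback.snd U.ι (𝒱.f i)).base y) ∈ (U : Set 𝒳.left)
    have e : ((pullback.snd U.ι (𝒱.f i)) ≫ 𝒱.f i).base y =
        ((pullback.fst U.ι (𝒱.f i)) ≫ U.ι).base y := by rw [pullback.condition]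
    change ((pullback.snd U.ι (𝒱.f i)) ≫ 𝒱.f i).base y ∈ (U : Set 𝒳.left)
    rw [e]
    exact ((pullback.fst U.ι (𝒱.f i)).base y).2

end LocalOnSource

section Inputs

variable (R : Type u) [CommRing R] [IsDomain R] [IsDiscreteValuationRing R] (K : Type u) [Field K]
  [Algebra R K] [IsFractionRing R K]

/-! ### Weil extension for an integral smooth source -/

/-- **Weil's extension theorem over a discrete valuation ring, integral smooth source** (BLR Thm. 4.4/1;
Artin, *Néron Models*, Prop. (1.3)): an `R`-morphism `g : U → 𝒜` into a separated group scheme locally of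
finite type, defined on an open `U` of the smooth integral `R`-scheme `𝒳` which contains the generic fibre and
every point `y` with `dim 𝒪_{X,y} ≤ 1`, extends to an `R`-morphism `𝒳 → 𝒜`.  (Affine integral case:
`weil_extension_of_codimOne`; glued over the non-empty affine opens by `openExtension_of_openCover_preimage`.)
[cite: BLRNeronModels1990, Thm. 4.4/1] [cite: Artin1986NeronModels, Prop. (1.3) (p. 215)] -/
theorem weil_extension_of_codimOne_of_isIntegral (𝒜 : Over (Spec (.of R))) [GrpObj 𝒜]
    [IsSeparated 𝒜.hom] [LocallyOfFiniteType 𝒜.hom] (𝒳 : Over (Spec (.of R))) [Smooth 𝒳.hom]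
    [IsIntegral 𝒳.left] (U : 𝒳.left.Opens)
    (hU : 𝒳.hom.base ⁻¹' Set.range (specGenericPoint R K).base ⊆ (U : Set 𝒳.left))
    (hU1 : ∀ y : 𝒳.left, ringKrullDim (𝒳.left.presheaf.stalk y) ≤ 1 → y ∈ U)
    (g : (U : Scheme.{u}) ⟶ 𝒜.left) (hg : g ≫ 𝒜.hom = U.ι ≫ 𝒳.hom) :
    ∃ f : 𝒳.left ⟶ 𝒜.left, f ≫ 𝒜.hom = 𝒳.hom ∧ U.ι ≫ f = g := by
  -- the open cover of `X` by its non-empty affine opens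
  let J : Type u := {V : 𝒳.left.affineOpens // Nonempty (V : 𝒳.left.Opens)}
  let 𝒱 : 𝒳.left.OpenCover :=
    Scheme.Cover.mkOfCovers J (fun V => ((V.1 : 𝒳.left.Opens) : Scheme.{u}))
      (fun V => (V.1 : 𝒳.left.Opens).ι) (fun x => by
        obtain ⟨W, hW, hxW, -⟩ := exists_isAffineOpen_mem_and_subset (X := 𝒳.left) (x := x)
          (U := ⊤) trivial
        exact ⟨⟨⟨W, hW⟩, ⟨⟨x, hxW⟩⟩⟩, ⟨x, hxW⟩, rfl⟩)
  refine openExtension_of_openCover_preimage R K 𝒜 𝒳 𝒱 U hU g (fun i r hr => ?_)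
  -- on a non-empty affine open `V` (integral, affine, smooth over `R`) apply the affine theorem
  let V : 𝒳.left.Opens := (i.1 : 𝒳.left.Opens)
  haveI : Nonempty V := i.2
  haveI hVaff : IsAffine (V : Scheme.{u}) := i.1.2
  haveI : IsIntegral (V : Scheme.{u}) := inferInstance
  let 𝒴 : Over (Spec (.of R)) := Over.mk (V.ι ≫ 𝒳.hom)
  have h𝒴 : Smooth 𝒴.hom := by
    change Smooth (V.ι ≫ 𝒳.hom)
    infer_instance
  have h𝒴i : IsIntegral 𝒴.left := by
    change IsIntegral (V : Scheme.{u})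
    infer_instance
  have hW : 𝒴.hom.base ⁻¹' Set.range (specGenericPoint R K).base ⊆
      ((V.ι ⁻¹ᵁ U : (V : Scheme.{u}).Opens) : Set (V : Scheme.{u})) := fun y hy => hU hy
  have hrg : (r ≫ g) ≫ 𝒜.hom = (V.ι ⁻¹ᵁ U).ι ≫ 𝒴.hom := by
    change (r ≫ g) ≫ 𝒜.hom = (V.ι ⁻¹ᵁ U).ι ≫ V.ι ≫ 𝒳.hom
    rw [Category.assoc, hg, ← Category.assoc]
    exact congrArg (· ≫ 𝒳.hom) hr
  exact weil_extension_of_codimOne R K 𝒜 𝒴 h𝒴 hVaff h𝒴i (V.ι ⁻¹ᵁ U) hW (r ≫ g) hrg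
    (fun y hy => by
      have e := ringKrullDim_eq_of_ringEquiv (asIso (V.ι.stalkMap y)).commRingCatIsoToRingEquiv
      have hy' : ringKrullDim (𝒳.left.presheaf.stalk (V.ι.base y)) ≤ 1 := by
        rw [e]; exact hy
      exact ⟨V.ι ⁻¹ᵁ U, hU1 _ hy', r ≫ g, rfl⟩)

/-! ### The isomorphism criterion (purity + Zariski) with a dominance binder -/

/-- **A proper dominant morphism of integral schemes onto a regular scheme, generically an isomorphism and with
surjective stalk maps in codimension `≤ 1`, is an isomorphism** — `isIso_of_isProper_of_isBirational_…` of
`ExceptionalLocusPurity` with `IsBirational` replaced by «`f` dominant and `𝒪_{Y,η_Y} → 𝒪_{X,η_X}` invertible».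
[cite: EGAIV4, 21.12.12] [cite: StacksProject, Tag 02LQ] -/
theorem isIso_of_isProper_of_isIso_stalkMap_genericPoint {X Y : Scheme.{u}} (f : X ⟶ Y) [IsIntegral X]
    [IsLocallyNoetherian X] [IsIntegral Y] [IsProper f] [IsDominant f]
    (hgen : IsIso (f.stalkMap (genericPoint X)))
    (hY : ∀ y : Y, IsRegularLocalRing (Y.presheaf.stalk y))
    (h1 : ∀ x : X, ringKrullDim (X.presheaf.stalk x) ≤ 1 → Function.Surjective (f.stalkMap x)) :
    IsIso f := by
  have hη : f.base (genericPoint X) = genericPoint Y := genericPoint_eq_of_isDominant f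
  have hbir : Function.Bijective (f.stalkMap (genericPoint X)) :=
    ConcreteCategory.bijective_of_isIso (f.stalkMap (genericPoint X))
  have hall : ∀ x, IsIso (f.stalkMap x) := fun x =>
    (ConcreteCategory.isIso_iff_bijective (f.stalkMap x)).mpr
      (stalkMap_bijective_of_forall_ringKrullDim_le_one f hη hbir h1 x (hY _))
  have hinj : Function.Injective f.base := by
    intro x₁ x₂ hx
    haveI := hall x₁
    haveI := hall x₂
    exact eq_of_apply_eq_of_isIso_stalkMap f hx
  haveI : LocallyQuasiFinite f := LocallyQuasiFinite.of_injective hinj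
  haveI : IsFinite f := IsFinite.of_isProper_of_locallyQuasiFinite f
  have hY' : ∀ y : Y, IsIntegrallyClosed (Y.presheaf.stalk y) := fun y => by
    haveI := isDomain_of_isRegularLocalRing (Y.presheaf.stalk y)
    haveI := uniqueFactorizationMonoid_of_isRegularLocalRing (Y.presheaf.stalk y) (hY y)
    infer_instance
  have key : MorphismProperty.isomorphisms Scheme f := by
    refine (IsZariskiLocalAtTarget.iff_of_iSup_eq_top
      (P := MorphismProperty.isomorphisms Scheme) _ (iSup_nonempty_affineOpens_eq_top Y)).mpr ?_
    rintro ⟨V, hVne⟩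
    show IsIso (f ∣_ (V : Y.Opens))
    haveI := hVne
    exact isIso_morphismRestrict_of_isIntegralHom_of_isIso_stalkMap f hY' hgen V
  exact key

/-! ### The node: a smooth proper model with a dense open group chunk is the group scheme -/

end Inputs

/-! ### §4 The isomorphism -/

section DVR

variable (R : Type u) [CommRing R] [IsDomain R] [IsDiscreteValuationRing R]
  (K : Type u) [Field K] [Algebra R K] [IsFractionRing R K]

/-- **Core of (W23): an `R`-morphism `f : 𝒳 → G` from a smooth proper `𝒳` to a smooth separated group scheme `G` (both with
integral total space) which restricts to an OPEN IMMERSION on an open `U` containing the generic fibre and all points of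
codimension `≤ 1` is an ISOMORPHISM** — `f` is proper (G separated) and birational, `G` is regular, and `f` is a local
isomorphism at every point of codimension `≤ 1` (they lie in `U`), so van der Waerden purity + Zariski's Main Theorem
(`isIso_of_isProper_of_isIso_stalkMap_genericPoint`, the dominant/generic-stalk form of ★
`isIso_of_isProper_of_isBirational_of_forall_ringKrullDim_le_one`) apply.
[cite: BLRNeronModels1990, §4.4 Thm. 1 and §4.3] [cite: EGAIV4, 21.12.12] -/
theorem isIso_of_isOpenImmersion_restrict_of_codimOne (𝒳 : Over (Spec (.of R))) [IsIntegral 𝒳.left] [Smooth 𝒳.hom] [IsProper 𝒳.hom]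
    (G : Over (Spec (.of R))) [IsIntegral G.left] [Smooth G.hom] [IsSeparated G.hom]
    (U : 𝒳.left.Opens) (hU : 𝒳.hom.base ⁻¹' Set.range (specGenericPoint R K).base ⊆ (U : Set 𝒳.left))
    (hU1 : ∀ y : 𝒳.left, ringKrullDim (𝒳.left.presheaf.stalk y) ≤ 1 → y ∈ U)
    (j : (U : Scheme.{u}) ⟶ G.left) [IsOpenImmersion j]
    (f : 𝒳.left ⟶ G.left) (hf : f ≫ G.hom = 𝒳.hom) (hUf : U.ι ≫ f = j) : IsIso f := by
  -- `f` is proper: `f ≫ G.hom = 𝒳.hom` is proper and `G.hom` is separated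
  haveI : IsProper (f ≫ G.hom) := by rw [hf]; infer_instance
  haveI : IsProper f := IsProper.of_comp f G.hom
  -- `𝒳` is locally noetherian (locally of finite type over the noetherian `Spec R`)
  haveI : IsLocallyNoetherian 𝒳.left := by
    haveI : LocallyOfFiniteType 𝒳.hom := inferInstance
    exact LocallyOfFiniteType.isLocallyNoetherian 𝒳.hom
  -- the generic point of `𝒳` lies in `U`, where `f = j` is an open immersion
  have hη : genericPoint 𝒳.left ∈ U := genericPoint_mem_of_preimage_subset (K := K) hU
  haveI : IsDominant f := isDominant_of_ι_comp_eq U ⟨_, hη⟩ f j hUf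
  have hgen : IsIso (f.stalkMap (genericPoint 𝒳.left)) := isIso_stalkMap_of_ι_comp_eq U f j hUf _ hη
  -- `G` is regular
  have hG : ∀ y : G.left, IsRegularLocalRing (G.left.presheaf.stalk y) := fun y =>
    isRegularLocalRing_stalk_of_smooth_dvr (𝒳 := G) y
  -- local isomorphism at points of codimension `≤ 1`
  have h1 : ∀ x : 𝒳.left, ringKrullDim (𝒳.left.presheaf.stalk x) ≤ 1 → Function.Surjective (f.stalkMap x) :=
    fun x hx => by
      haveI := isIso_stalkMap_of_ι_comp_eq U f j hUf x (hU1 x hx)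
      exact (ConcreteCategory.bijective_of_isIso (f.stalkMap x)).2
  exact isIso_of_isProper_of_isIso_stalkMap_genericPoint f hgen hG h1

/-- **(W23) «extension + purity ⇒ the smooth proper model IS the group scheme»** (B-plan1 RULING R-W23; BLR §4.3–4.4 with
van der Waerden purity in place of the ω-argument).  `R` a discrete valuation ring with fraction field `K`; `𝒳 → Spec R` smooth
proper, `G → Spec R` a smooth separated group scheme locally of finite type, both with integral total space; `U ⊆ 𝒳` open,
containing the generic fibre and every point of codimension `≤ 1`; `j : U ↪ G` an open immersion over `R`.  Then there is an
isomorphism `u : 𝒳 ≅ G` over `R` extending `j`, and every `R`-morphism `𝒳 → G` extending `j` equals `u`.  Inputs: the global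
Weil extension `weil_extension_of_codimOne_of_isIntegral` (★ `weil_extension_of_codimOne` glued over an affine cover) and the
purity/ZMT criterion `isIso_of_isProper_of_isIso_stalkMap_genericPoint`.
[cite: BLRNeronModels1990, §4.4 Thm. 1] [cite: Artin1986NeronModels, Prop. (1.3)] [cite: EGAIV4, 21.12.12] -/
theorem exists_iso_of_isOpenImmersion_of_codimOne (𝒳 : Over (Spec (.of R))) [IsIntegral 𝒳.left] [Smooth 𝒳.hom] [IsProper 𝒳.hom]
    (G : Over (Spec (.of R))) [GrpObj G] [IsIntegral G.left] [Smooth G.hom] [IsSeparated G.hom]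
    [LocallyOfFiniteType G.hom]
    (U : 𝒳.left.Opens) (hU : 𝒳.hom.base ⁻¹' Set.range (specGenericPoint R K).base ⊆ (U : Set 𝒳.left))
    (hU1 : ∀ y : 𝒳.left, ringKrullDim (𝒳.left.presheaf.stalk y) ≤ 1 → y ∈ U)
    (j : (U : Scheme.{u}) ⟶ G.left) [IsOpenImmersion j] (hj : j ≫ G.hom = U.ι ≫ 𝒳.hom) :
    ∃ u : 𝒳 ≅ G, U.ι ≫ u.hom.left = j ∧
      ∀ f : 𝒳.left ⟶ G.left, f ≫ G.hom = 𝒳.hom → U.ι ≫ f = j → f = u.hom.left := by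
  -- Weil extension: the local hypothesis is trivial since the points of codimension `≤ 1` lie in `U`
  obtain ⟨f, hf, hUf⟩ := weil_extension_of_codimOne_of_isIntegral R K G 𝒳 U hU hU1 j hj
  haveI : IsIso f := isIso_of_isOpenImmersion_restrict_of_codimOne R K 𝒳 G U hU hU1 j f hf hUf
  refine ⟨Over.isoMk (asIso f) (by simpa using hf), by simpa using hUf, fun g hg hUg => ?_⟩
  -- uniqueness: `G` is separated over `R`, `𝒳` is flat over `R`, and `g`, `f` agree on `U ⊇` generic fibre
  haveI : Flat 𝒳.hom := inferInstance
  have hfl : (Over.isoMk (asIso f) (by simpa using hf) : 𝒳 ≅ G).hom.left = f := by simp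
  rw [hfl]
  exact hom_ext_of_ι_comp_eq (R := R) (K := K) G 𝒳 U hU hg hf (by rw [hUg, hUf])

/-- **(W23), B-plan1's wording: a smooth proper model with IRREDUCIBLE special fibre which is a group chunk of a smooth separated
group scheme `G` on an open `U ⊇` generic fibre meeting the special fibre IS `G`.**  (`hU1` of
`exists_iso_of_isOpenImmersion_of_codimOne` is discharged by `mem_of_ringKrullDim_le_one_of_isIrreducible_specialFibre`.)
[cite: BLRNeronModels1990, §4.4 Thm. 1] [cite: Artin1986NeronModels, Prop. (1.3)] [cite: EGAIV4, 21.12.12] -/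
theorem exists_iso_of_isOpenImmersion_of_isIrreducible_specialFibre (𝒳 : Over (Spec (.of R))) [IsIntegral 𝒳.left] [Smooth 𝒳.hom] [IsProper 𝒳.hom]
    (hirr : IsIrreducible (𝒳.hom.base ⁻¹' {closedPoint R}))
    (G : Over (Spec (.of R))) [GrpObj G] [IsIntegral G.left] [Smooth G.hom] [IsSeparated G.hom]
    [LocallyOfFiniteType G.hom]
    (U : 𝒳.left.Opens) (hU : 𝒳.hom.base ⁻¹' Set.range (specGenericPoint R K).base ⊆ (U : Set 𝒳.left))
    (hUs : ((U : Set 𝒳.left) ∩ 𝒳.hom.base ⁻¹' {closedPoint R}).Nonempty)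
    (j : (U : Scheme.{u}) ⟶ G.left) [IsOpenImmersion j] (hj : j ≫ G.hom = U.ι ≫ 𝒳.hom) :
    ∃ u : 𝒳 ≅ G, U.ι ≫ u.hom.left = j ∧
      ∀ f : 𝒳.left ⟶ G.left, f ≫ G.hom = 𝒳.hom → U.ι ≫ f = j → f = u.hom.left :=
  exists_iso_of_isOpenImmersion_of_codimOne R K 𝒳 G U hU
    (mem_of_ringKrullDim_le_one_of_isIrreducible_specialFibre (K := K) 𝒳 hirr U hU hUs) j hj

end DVR


end Literature.NumberTheory.DiophantineGeometry

end
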